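/-
Copyright: b2b-lace packet (carver, gen 43).  Soundness of the CELL CHECK for bounded trigonometric
majorants of `|t|` on `[-1,1]` — the hypothesis `hmaj` of `SrwTrigMajorant.lean` (KU-SEP device, census v7,
`carver/g43/cosh/KU-SEP-SPEC.md` §3 item 1) reduced to finitely many inequalities between real numbers at
grid points.  d-free, number-free; the enclosures of `cos`/`sin` at the grid points are hypotheses.
-/
import Literature.Probability.FitznerVanDerHofstad2017.SrwIntegralV
import HarnessLib

/-!
# Cell-check soundness for trigonometric majorants of `|t|`

The NoBLE analysis [NoBLE17-I, §5.2 (5.9)/(5.14) p. 1092] bounds the SRW integrals `K_{n,l}(x)`,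
`U_{n,l}(x)` ((3.36)–(3.38) p. 1071) by Cauchy–Schwarz, i.e. by the quadratic majorant
`|t| ≤ (λ + λ⁻¹t²)/2` of the symmetrised exponential `t = D̂^{(x)}(k) ∈ [-1,1]`.  The companion file
`SrwTrigMajorant.lean` replaces the quadratic by any BOUNDED trigonometric majorant

  `g(t) = B + c t² + Σ_{r<R} a_r cos(b_r t) ≥ |t|`  on `[-1, 1]`,                       (M)

under which the bound separates over coordinates.  This file proves that (M) follows from a FINITE
CELL CHECK, so that a certifying engine only has to verify inequalities between enclosed real numbers:
with `N` cells of half-width `h = 1/(2N)` and centres `x_i = (2i+1)h` covering `[0,1]`, lower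
enclosures `gLo_i ≤ g(x_i)`, upper enclosures `|g'(x_i) − 1| ≤ dAbs_i` and `M₂ ≤ M2up` for the
second-derivative bound `M₂ = 2|c| + Σ_r |a_r| b_r²`, the conditions

  `0 ≤ gLo_i − x_i − h·(dAbs_i + M2up·h)`   for all `i < N`                              (C)

imply (M) (evenness of `g` and `|·|` handles `[-1,0]`).  The proof is the mean value inequality twice
(`Convex.norm_image_sub_le_of_norm_hasDerivWithin_le`): `|g'(s) − g'(x_i)| ≤ M₂|s − x_i|` on the cell,
hence `g(t) − t ≥ (g(x_i) − x_i) − h|g'(x_i) − 1| − M₂h²`.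

## Main statements
* `trigMaj`, `trigMajDeriv`, `trigMajM2` — the family (M), its derivative, the bound `M₂`;
  `hasDerivAt_trigMaj`, `hasDerivAt_trigMajDeriv`, `abs_trigMajDeriv2_le`, `trigMaj_neg`, `trigMaj_abs`.
* `trigMaj_sub_ge_of_abs_sub_le` — the one-cell Taylor-type lower bound.
* **`abs_le_trigMaj_of_cellCheck`** — (C) ⇒ (M), in the exact shape of the hypothesis `hmaj` of
  `integral_weight_abs_DhatSym_le_of_trigMajorant` / `srwK_le_of_trigMajorant` / `srwU_le_of_trigMajorant`.

## What is NOT here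
No dimension, no coefficient set, no enclosure arithmetic for `cos`/`sin` at rationals (that is the
certificate's kernel side), no value of any SRW integral; nothing of record (CERT REV 14, `d = 11`) and no
`d = 10` module is touched; no `…Of`/`…At` instance.  Lane: what-if / input-certification support.

## References
* [NoBLE17-I] R. Fitzner, R. van der Hofstad, PTRF 169 (2017) 1041–1119; arXiv:1506.07969 — (3.36)–(3.38)
  p. 1071; §5.2 (5.9), (5.14) p. 1092 (the majorant step being generalised).
* [HS92b] T. Hara, G. Slade, Reviews in Math. Physics 4 (1992) 235–327 — App. B (rigorous numerical bounds
  by Taylor enclosures on cells, the pattern of (C)).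
-/

noncomputable section

open Real Finset Set
open scoped BigOperators

namespace Literature.Probability.FitznerVanDerHofstad2017

variable {R : ℕ}

/-! ### The family, its derivatives, evenness -/

/-- The bounded trigonometric majorant family `g(t) = B + c t² + Σ_r a_r cos(b_r t)` (generalising the
quadratic `(λ + λ⁻¹ t²)/2` of the Cauchy–Schwarz step (5.9)).
[cite: FitznerVanDerHofstad2016NoBLE, (5.9) p. 1092] -/
def trigMaj (B c : ℝ) (a b : Fin R → ℝ) (t : ℝ) : ℝ :=
  B + c * t ^ 2 + ∑ r, a r * Real.cos (b r * t)

/-- Its derivative `g'(t) = 2ct − Σ_r a_r b_r sin(b_r t)`.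
[cite: FitznerVanDerHofstad2016NoBLE, (5.9) p. 1092] -/
def trigMajDeriv (c : ℝ) (a b : Fin R → ℝ) (t : ℝ) : ℝ :=
  2 * c * t - ∑ r, a r * b r * Real.sin (b r * t)

/-- Its second derivative `g''(t) = 2c − Σ_r a_r b_r² cos(b_r t)`.
[cite: FitznerVanDerHofstad2016NoBLE, (5.9) p. 1092] -/
def trigMajDeriv2 (c : ℝ) (a b : Fin R → ℝ) (t : ℝ) : ℝ :=
  2 * c - ∑ r, a r * b r ^ 2 * Real.cos (b r * t)

/-- The uniform bound `M₂ = 2|c| + Σ_r |a_r| b_r²` on `|g''|`.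
[cite: FitznerVanDerHofstad2016NoBLE, (5.9) p. 1092] -/
def trigMajM2 (c : ℝ) (a b : Fin R → ℝ) : ℝ :=
  2 * |c| + ∑ r, |a r| * b r ^ 2

/-- `g` has derivative `g'`. [cite: FitznerVanDerHofstad2016NoBLE, (5.9) p. 1092] -/
theorem hasDerivAt_trigMaj (B c : ℝ) (a b : Fin R → ℝ) (t : ℝ) :
    HasDerivAt (trigMaj B c a b) (trigMajDeriv c a b t) t := by
  have h1 : HasDerivAt (fun t : ℝ => B + c * t ^ 2) (2 * c * t) t := by
    refine (((hasDerivAt_pow 2 t).const_mul c).const_add B).congr_deriv ?_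
    norm_num
    try ring
  have h2 : HasDerivAt (fun t : ℝ => ∑ r, a r * Real.cos (b r * t))
      (∑ r, a r * (-Real.sin (b r * t) * b r)) t := by
    refine HasDerivAt.fun_sum fun r _ => ?_
    exact ((Real.hasDerivAt_cos (b r * t)).comp t ((hasDerivAt_id t).const_mul (b r) |>.congr_deriv
      (by simp))).const_mul (a r)
  have h := h1.add h2
  have e : 2 * c * t + ∑ r, a r * (-Real.sin (b r * t) * b r) = trigMajDeriv c a b t := by
    rw [trigMajDeriv, sub_eq_add_neg, ← Finset.sum_neg_distrib]
    congr 1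
    exact Finset.sum_congr rfl fun r _ => by ring
  rw [← e]
  exact h.congr_of_eventuallyEq (Filter.Eventually.of_forall fun s => by simp [trigMaj, add_assoc])

/-- `g'` has derivative `g''`. [cite: FitznerVanDerHofstad2016NoBLE, (5.9) p. 1092] -/
theorem hasDerivAt_trigMajDeriv (c : ℝ) (a b : Fin R → ℝ) (t : ℝ) :
    HasDerivAt (trigMajDeriv c a b) (trigMajDeriv2 c a b t) t := by
  have h1 : HasDerivAt (fun t : ℝ => 2 * c * t) (2 * c) t := by
    simpa using (hasDerivAt_id t).const_mul (2 * c)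
  have h2 : HasDerivAt (fun t : ℝ => ∑ r, a r * b r * Real.sin (b r * t))
      (∑ r, a r * b r * (Real.cos (b r * t) * b r)) t := by
    refine HasDerivAt.fun_sum fun r _ => ?_
    exact ((Real.hasDerivAt_sin (b r * t)).comp t ((hasDerivAt_id t).const_mul (b r) |>.congr_deriv
      (by simp))).const_mul (a r * b r)
  have h := h1.sub h2
  have e : 2 * c - ∑ r, a r * b r * (Real.cos (b r * t) * b r) = trigMajDeriv2 c a b t := by
    rw [trigMajDeriv2]
    congr 1
    exact Finset.sum_congr rfl fun r _ => by ring
  rw [← e]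
  exact h.congr_of_eventuallyEq (Filter.Eventually.of_forall fun s => by simp [trigMajDeriv])

/-- `|g''(t)| ≤ M₂`. [cite: FitznerVanDerHofstad2016NoBLE, (5.9) p. 1092] -/
theorem abs_trigMajDeriv2_le (c : ℝ) (a b : Fin R → ℝ) (t : ℝ) :
    |trigMajDeriv2 c a b t| ≤ trigMajM2 c a b := by
  rw [trigMajDeriv2, trigMajM2]
  refine (abs_sub _ _).trans (add_le_add ?_ ?_)
  · rw [abs_mul, Nat.abs_ofNat]
  · refine (Finset.abs_sum_le_sum_abs _ _).trans (Finset.sum_le_sum fun r _ => ?_)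
    rw [abs_mul, abs_mul, abs_pow, sq_abs]
    exact mul_le_of_le_one_right (mul_nonneg (abs_nonneg _) (sq_nonneg _)) (Real.abs_cos_le_one _)

/-- `g` is even. [cite: FitznerVanDerHofstad2016NoBLE, (5.9) p. 1092] -/
theorem trigMaj_neg (B c : ℝ) (a b : Fin R → ℝ) (t : ℝ) :
    trigMaj B c a b (-t) = trigMaj B c a b t := by
  simp [trigMaj, mul_neg, Real.cos_neg]

/-- `g(|t|) = g(t)`. [cite: FitznerVanDerHofstad2016NoBLE, (5.9) p. 1092] -/
theorem trigMaj_abs (B c : ℝ) (a b : Fin R → ℝ) (t : ℝ) :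
    trigMaj B c a b |t| = trigMaj B c a b t := by
  rcases le_or_gt 0 t with ht | ht
  · rw [abs_of_nonneg ht]
  · rw [abs_of_neg ht, trigMaj_neg]

/-! ### One cell: the Taylor-type lower bound -/

/-- On a cell `|t − x| ≤ h`: `g(t) − t ≥ (g(x) − x) − h·(|g'(x) − 1| + M₂ h)` (mean value inequality
applied to `g'` and then to `s ↦ g(s) − s − (g'(x) − 1)s`).
[cite: FitznerVanDerHofstad2016NoBLE, (5.9) p. 1092] -/
theorem trigMaj_sub_ge_of_abs_sub_le (B c : ℝ) (a b : Fin R → ℝ) {x t h : ℝ}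
    (hxt : |t - x| ≤ h) :
    trigMaj B c a b x - x - h * (|trigMajDeriv c a b x - 1| + trigMajM2 c a b * h) ≤
      trigMaj B c a b t - t := by
  have hh : 0 ≤ h := (abs_nonneg _).trans hxt
  set S : Set ℝ := Set.Icc (x - h) (x + h) with hS
  have hxS : x ∈ S := ⟨by linarith, by linarith⟩
  have htS : t ∈ S := by
    rcases abs_le.1 hxt with ⟨h1, h2⟩
    exact ⟨by linarith, by linarith⟩
  have hdist : ∀ s ∈ S, |s - x| ≤ h := fun s hs => abs_le.2 ⟨by linarith [hs.1], by linarith [hs.2]⟩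
  -- (1) `|g'(s) − g'(x)| ≤ M₂ |s − x| ≤ M₂ h` on the cell
  have hD : ∀ s ∈ S, |trigMajDeriv c a b s - trigMajDeriv c a b x| ≤ trigMajM2 c a b * h := by
    intro s hs
    have key := (convex_Icc (x - h) (x + h)).norm_image_sub_le_of_norm_hasDerivWithin_le
      (f := trigMajDeriv c a b) (f' := trigMajDeriv2 c a b)
      (fun y _ => (hasDerivAt_trigMajDeriv c a b y).hasDerivWithinAt)
      (fun y _ => by rw [Real.norm_eq_abs]; exact abs_trigMajDeriv2_le c a b y) hxS hs
    rw [Real.norm_eq_abs, Real.norm_eq_abs] at key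
    exact key.trans (mul_le_mul_of_nonneg_left (hdist s hs)
      ((abs_nonneg _).trans (abs_trigMajDeriv2_le c a b x)))
  -- (2) `F(s) = g(s) − s − (g'(x) − 1)s` has `|F'| ≤ M₂ h` on the cell
  set F : ℝ → ℝ := fun s => trigMaj B c a b s - s - (trigMajDeriv c a b x - 1) * s with hF
  have hF' : ∀ s ∈ S, HasDerivWithinAt F (trigMajDeriv c a b s - trigMajDeriv c a b x) S s := by
    intro s _
    have h := ((hasDerivAt_trigMaj B c a b s).sub (hasDerivAt_id' s)).sub
      ((hasDerivAt_id' s).const_mul (trigMajDeriv c a b x - 1))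
    refine (h.congr_deriv ?_).hasDerivWithinAt
    rw [mul_one]
    ring
  have key := (convex_Icc (x - h) (x + h)).norm_image_sub_le_of_norm_hasDerivWithin_le hF'
    (fun y hy => by rw [Real.norm_eq_abs]; exact hD y hy) hxS htS
  rw [Real.norm_eq_abs, Real.norm_eq_abs] at key
  have hFt : |F t - F x| ≤ trigMajM2 c a b * h * h :=
    key.trans (mul_le_mul_of_nonneg_left hxt (mul_nonneg
      ((abs_nonneg _).trans (abs_trigMajDeriv2_le c a b x)) hh))
  -- (3) assemble
  have e : trigMaj B c a b t - t =
      (trigMaj B c a b x - x) + (F t - F x) + (trigMajDeriv c a b x - 1) * (t - x) := by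
    simp only [hF]
    ring
  rw [e]
  have h3 : -(|trigMajDeriv c a b x - 1| * h) ≤ (trigMajDeriv c a b x - 1) * (t - x) := by
    have := neg_abs_le ((trigMajDeriv c a b x - 1) * (t - x))
    rw [abs_mul] at this
    nlinarith [abs_nonneg (trigMajDeriv c a b x - 1), abs_nonneg (t - x)]
  nlinarith [neg_abs_le (F t - F x), hFt, h3]

/-- Cell membership from the floor data: `i ≤ sN ≤ i+1` gives `|s − (2i+1)/(2N)| ≤ 1/(2N)`. [folklore] -/
private theorem abs_sub_centre_le {N s i : ℝ} (hN : 0 < N) (h1 : i ≤ s * N) (h2 : s * N ≤ i + 1) :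
    |s - (2 * i + 1) / (2 * N)| ≤ 1 / (2 * N) := by
  have two0 : (2 : ℝ) ≠ 0 := two_ne_zero
  have elo : (2 * i + 1) / (2 * N) - 1 / (2 * N) = i / N := by
    rw [← sub_div, show 2 * i + 1 - 1 = 2 * i by ring, mul_div_mul_left i N two0]
  have ehi : (2 * i + 1) / (2 * N) + 1 / (2 * N) = (i + 1) / N := by
    rw [← add_div, show 2 * i + 1 + 1 = 2 * (i + 1) by ring, mul_div_mul_left (i + 1) N two0]
  have hlo : i / N ≤ s := by rw [div_le_iff₀ hN]; exact h1
  have hhi : s ≤ (i + 1) / N := by rw [le_div_iff₀ hN]; exact h2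
  rw [abs_le]
  constructor <;> linarith

/-! ### The cell check -/

/-- **Cell-check soundness.**  `N ≥ 1` cells of half-width `h = 1/(2N)` with centres `x_i = (2i+1)/(2N)`;
if `gLo_i ≤ g(x_i)`, `|g'(x_i) − 1| ≤ dAbs_i`, `M₂ ≤ M2up` and
`0 ≤ gLo_i − x_i − h (dAbs_i + M2up h)` for every `i < N`, then `|t| ≤ g(t)` for all `t ∈ [-1,1]` —
the hypothesis `hmaj` of `srwK_le_of_trigMajorant` / `srwU_le_of_trigMajorant` (the quadratic case being
(5.9)). [cite: FitznerVanDerHofstad2016NoBLE, (5.9) p. 1092; (5.14) p. 1092] -/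
theorem abs_le_trigMaj_of_cellCheck (B c : ℝ) (a b : Fin R → ℝ) {N : ℕ} (hN : 0 < N)
    (gLo dAbs : Fin N → ℝ) (M2up : ℝ)
    (hg : ∀ i : Fin N, gLo i ≤ trigMaj B c a b ((2 * (i : ℝ) + 1) / (2 * N)))
    (hd : ∀ i : Fin N, |trigMajDeriv c a b ((2 * (i : ℝ) + 1) / (2 * N)) - 1| ≤ dAbs i)
    (hM : trigMajM2 c a b ≤ M2up)
    (hcheck : ∀ i : Fin N,
      0 ≤ gLo i - (2 * (i : ℝ) + 1) / (2 * N) - 1 / (2 * N) * (dAbs i + M2up * (1 / (2 * N)))) :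
    ∀ t ∈ Set.Icc (-1 : ℝ) 1, |t| ≤ trigMaj B c a b t := by
  intro t ht
  -- reduce to `s = |t| ∈ [0,1]`
  rw [← trigMaj_abs]
  set s := |t| with hs
  have hs0 : 0 ≤ s := abs_nonneg t
  have hs1 : s ≤ 1 := abs_le.2 ⟨ht.1, ht.2⟩
  have hNr : (0 : ℝ) < N := by exact_mod_cast hN
  have hh : (0 : ℝ) ≤ 1 / (2 * N) := by positivity
  -- the cell containing `s`
  obtain ⟨i, hi⟩ : ∃ i : Fin N, |s - (2 * (i : ℝ) + 1) / (2 * N)| ≤ 1 / (2 * N) := by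
    have hfl : (⌊s * N⌋₊ : ℝ) ≤ s * N := Nat.floor_le (mul_nonneg hs0 hNr.le)
    by_cases hlt : ⌊s * N⌋₊ < N
    · exact ⟨⟨⌊s * N⌋₊, hlt⟩, abs_sub_centre_le hNr hfl (Nat.lt_floor_add_one _).le⟩
    · refine ⟨⟨N - 1, Nat.sub_lt hN Nat.one_pos⟩, ?_⟩
      have h1 : (N : ℝ) ≤ ⌊s * N⌋₊ := by exact_mod_cast not_lt.1 hlt
      have hc : (((N - 1 : ℕ) : ℕ) : ℝ) = (N : ℝ) - 1 := by
        rw [Nat.cast_sub (Nat.one_le_of_lt hN), Nat.cast_one]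
      rw [hc]
      exact abs_sub_centre_le hNr (by linarith) (by nlinarith)
  -- the one-cell bound, then monotonicity in the enclosures
  have hcell := trigMaj_sub_ge_of_abs_sub_le B c a b (x := (2 * (i : ℝ) + 1) / (2 * N)) (t := s)
    (h := 1 / (2 * N)) hi
  have hmono : gLo i - (2 * (i : ℝ) + 1) / (2 * N) - 1 / (2 * N) * (dAbs i + M2up * (1 / (2 * N))) ≤
      trigMaj B c a b ((2 * (i : ℝ) + 1) / (2 * N)) - (2 * (i : ℝ) + 1) / (2 * N)
        - 1 / (2 * N) * (|trigMajDeriv c a b ((2 * (i : ℝ) + 1) / (2 * N)) - 1|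
          + trigMajM2 c a b * (1 / (2 * N))) := by
    have := mul_le_mul_of_nonneg_left
      (add_le_add (hd i) (mul_le_mul_of_nonneg_right hM hh)) hh
    linarith [hg i]
  have : 0 ≤ trigMaj B c a b s - s := (hcheck i).trans (hmono.trans hcell)
  linarith

/-- The family `trigMaj` unfolds to the shape of the hypothesis `hmaj` of `SrwTrigMajorant.lean`.
[cite: FitznerVanDerHofstad2016NoBLE, (5.9) p. 1092] -/
theorem abs_le_of_cellCheck (B c : ℝ) (a b : Fin R → ℝ) {N : ℕ} (hN : 0 < N)
    (gLo dAbs : Fin N → ℝ) (M2up : ℝ)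
    (hg : ∀ i : Fin N, gLo i ≤ trigMaj B c a b ((2 * (i : ℝ) + 1) / (2 * N)))
    (hd : ∀ i : Fin N, |trigMajDeriv c a b ((2 * (i : ℝ) + 1) / (2 * N)) - 1| ≤ dAbs i)
    (hM : trigMajM2 c a b ≤ M2up)
    (hcheck : ∀ i : Fin N,
      0 ≤ gLo i - (2 * (i : ℝ) + 1) / (2 * N) - 1 / (2 * N) * (dAbs i + M2up * (1 / (2 * N)))) :
    ∀ t ∈ Set.Icc (-1 : ℝ) 1, |t| ≤ B + c * t ^ 2 + ∑ r, a r * Real.cos (b r * t) :=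
  abs_le_trigMaj_of_cellCheck B c a b hN gLo dAbs M2up hg hd hM hcheck

end Literature.Probability.FitznerVanDerHofstad2017

end
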